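import Summits.ResolutionOfSingularities.ResolutionOfSingularities.Theorems.PurelyInseparableDim4ResConeFrobeniusShear
import Summits.ResolutionOfSingularities.ResolutionOfSingularities.Theorems.PurelyInseparableDim4ResConeCornerTransport
import Mathlib.Algebra.MvPolynomial.Division
import HarnessLib
import HarnessLib.Audit.Tags

/-!
# Purely inseparable four-folds — PEELING THE TRANSLATED COMPONENT and ROW TRIANGULARITY of the shear
# (K2(p) lane, SLICE C, tilt-free D∞ brick, FILE 1a: pure algebra; file-holder res-dim4-p-5 g4)

[OURS · counted 0 · cell `res-dim4-pi` · K2(p) lane, slice C (desk WORDS #128 (h), #130 (b)) · seat p-5 g4.]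
Nothing here proves K2(p), `NoIsolatedTrap p p` or resolution of singularities in dimension ≥ 4 / char. `p`.

At a LOSE-BOTH step of a binary-cone tail (chart `a`, point `t·e_{a′}`, `t ≠ 0`, boundary `x^r = x_a^α x_{a′}^β`)
the polynomial model keeps the translated old component as a factor: `shear (x^r · G) = x_a^α (x_{a′} + t x_a)^β ·
shear G`.  idea-4's E2 §D reads the «realised» `x_{a′}`-exponents of the sheared RESIDUAL factor `shear G`; this file
supplies the two pieces of bookkeeping that transport statements about `shear (x^r G)` to `shear G` and back to `G`:
* `shear_monomial_pair`, `eq_monomial_mul_divMonomial`, `coeff_unitRow_mul` — the unit factor and its coefficient law;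
* **`peel`** — if `x_a^α (x_{a′} + t x_a)^β · Q` has no monomial of `x_{a′}`-exponent `< N` on a row, neither has `Q`
  (the lowest `x_{a′}`-power of the unit is `t^β x_a^β ≠ 0`; induction on the `x_{a′}`-exponent);
* **`row_coeff_eq_zero_of_shear`** — on a row `{x_a^{n−j} x_{a′}^j x^{μ₀}}` the shear `x_{a′} ↦ x_{a′} + t x_a` is
  unitriangular (`…ShearTransport.coeff_shear_single`, diagonal `C(j,0) = 1`): a row killed after the shear was zero;
* `coeff_rowSum`, `exists_of_mem_support_rowSum`, `coeff_shear_rowSum` — the ROW POLYNOMIAL of `G` and the locality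
  of the shear on rows (the form in which `…FrobeniusShear.row_eq_frobeniusRow_of_shear_order_ge` is applied).
Alphabet-abstract in the sense of res-dim4-idea-4 g4 (bus 2026-08-29T02:36:10Z): `a, a′` are the only letters that
are ever charts / boundary / translated; the two other letters are inert.
[cite: Hauser2010, §I (definition of P⁺)] [cite: CossartJannsenSaito2020, Lemma 13.2, Thm. 13.7]
bears_on: LADDER-RESOLUTION:D157-DOOR2 (res-dim4-pi · K2(p) = `RidgeBudget.NoAboveFloorTrap p p` · slice C, lossy residual,
D∞ tilt-free).  Supports stmt-ResolutionOfSingularities-16155 (helper).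
-/

set_option linter.dupNamespace false -- mandated namespace of this single-conjunct summit

noncomputable section

namespace Summit.ResolutionOfSingularities.ResolutionOfSingularities.Theorems.PIDim4

namespace ResCone

open MvPolynomial Finset
open Literature.AlgebraicGeometry.Resolution
open Literature.AlgebraicGeometry.Resolution.CentreBlowup
open Literature.AlgebraicGeometry.Resolution.Hauser2010

variable {K : Type} [Field K]

section Peel

/-- **The sheared boundary monomial**: `shear a (t e_{a′}) (x_a^α x_{a′}^β) = x_a^α (x_{a′} + t x_a)^β =
Σ_{l ≤ β} C(β, l) t^l · x_a^{α+l} x_{a′}^{β−l}`. [folklore] [cite: Hauser2010, §I (definition of P⁺)] -/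
theorem shear_monomial_pair {a a' : Fin 4} (haa : a ≠ a') (t : K) (α β : ℕ) :
    shear a (Pi.single a' t) (monomial (Finsupp.single a α + Finsupp.single a' β) (1 : K)) =
      ∑ l ∈ Finset.range (β + 1),
        monomial (Finsupp.single a (α + l) + Finsupp.single a' (β - l)) (((β.choose l : ℕ) : K) * t ^ l) := by
  rw [shear_single_monomial haa]
  have hma' : (Finsupp.single a α + Finsupp.single a' β : Fin 4 →₀ ℕ) a' = β := by
    rw [Finsupp.add_apply, Finsupp.single_eq_of_ne haa.symm, Finsupp.single_eq_same, zero_add]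
  have hma : (Finsupp.single a α + Finsupp.single a' β : Fin 4 →₀ ℕ) a = α := by
    rw [Finsupp.add_apply, Finsupp.single_eq_same, Finsupp.single_eq_of_ne haa, add_zero]
  rw [hma']
  refine Finset.sum_congr rfl fun l _ => ?_
  have hexp : ((Finsupp.single a α + Finsupp.single a' β : Fin 4 →₀ ℕ).update a' (β - l)).update a
      ((Finsupp.single a α + Finsupp.single a' β : Fin 4 →₀ ℕ) a + l) =
      Finsupp.single a (α + l) + Finsupp.single a' (β - l) := by
    ext i
    rw [hma, Finsupp.coe_update, Finsupp.coe_update, Finsupp.add_apply, Finsupp.single_apply,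
      Finsupp.single_apply]
    by_cases hia : i = a
    · subst hia
      rw [Function.update_self, if_pos rfl, if_neg haa.symm, add_zero]
    · rw [Function.update_of_ne hia, if_neg (Ne.symm hia), zero_add]
      by_cases hia' : i = a'
      · subst hia'
        rw [Function.update_self, if_pos rfl]
      · rw [Function.update_of_ne hia', if_neg (Ne.symm hia'), Finsupp.add_apply, Finsupp.single_eq_of_ne hia,
          Finsupp.single_eq_of_ne hia', add_zero]
  rw [hexp, one_mul]

/-- A polynomial all of whose monomials are divisible by `x^r` is `x^r` times its monomial quotient. [folklore] -/
theorem eq_monomial_mul_divMonomial {F : MvPolynomial (Fin 4) K} {r : Fin 4 →₀ ℕ}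
    (hr : ∀ e ∈ F.support, r ≤ e) : F = monomial r (1 : K) * F.divMonomial r := by
  have hmod : F.modMonomial r = 0 := by
    ext e
    rw [coeff_zero]
    by_cases hle : r ≤ e
    · exact coeff_modMonomial_of_le F hle
    · rw [coeff_modMonomial_of_not_le F hle]
      by_contra hne
      exact hle (hr e (MvPolynomial.mem_support_iff.mpr hne))
  conv_lhs => rw [← divMonomial_add_modMonomial F r, hmod, add_zero]

/-- Coefficients of the quotient: `coeff e (F / x^r) = coeff (r + e) F`. [folklore] -/
theorem coeff_divMonomial_pair (F : MvPolynomial (Fin 4) K) (r e : Fin 4 →₀ ℕ) :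
    coeff e (F.divMonomial r) = coeff (r + e) F := coeff_divMonomial r F e

/-- **The coefficient law of the unit factor**: multiplying by the sheared boundary monomial
`x_a^α (x_{a′} + t x_a)^β` reads, at the exponent `E`, the coefficients of `Q` at `E − (α+l) e_a − (β−l) e_{a′}`.
[folklore] -/
theorem coeff_unitRow_mul (a a' : Fin 4) (t : K) (α β : ℕ) (Q : MvPolynomial (Fin 4) K) (E : Fin 4 →₀ ℕ) :
    coeff E ((∑ l ∈ Finset.range (β + 1),
        monomial (Finsupp.single a (α + l) + Finsupp.single a' (β - l)) (((β.choose l : ℕ) : K) * t ^ l)) * Q) =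
      ∑ l ∈ Finset.range (β + 1),
        if Finsupp.single a (α + l) + Finsupp.single a' (β - l) ≤ E then
          ((β.choose l : ℕ) : K) * t ^ l * coeff (E - (Finsupp.single a (α + l) + Finsupp.single a' (β - l))) Q
        else 0 := by
  rw [Finset.sum_mul, coeff_sum]
  refine Finset.sum_congr rfl fun l _ => ?_
  rw [coeff_monomial_mul']

/-- **PEELING THE UNIT FACTOR** (the triangular lemma): if the product `x_a^α (x_{a′} + t x_a)^β · Q`, `t ≠ 0`, has
no monomial of `x_{a′}`-exponent `< N` in the row `{e + (α+β) e_a : e_a + e_{a′} = D, inert part κ}`, then `Q` has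
no monomial of `x_{a′}`-exponent `< N` in the row `{e_a + e_{a′} = D, inert part κ}` — the lowest `x_{a′}`-power of
the unit is `t^β x_a^β ≠ 0`. [OURS · bookkeeping] [cite: Hauser2010, §I (definition of P⁺)] -/
theorem peel {a a' : Fin 4} (haa : a ≠ a') {t : K} (ht : t ≠ 0) (α β : ℕ) (Q : MvPolynomial (Fin 4) K)
    (D : ℕ) (κ : Fin 4 → ℕ) (N : ℕ)
    (h : ∀ e : Fin 4 →₀ ℕ, e a + e a' = D → (∀ i, i ≠ a → i ≠ a' → e i = κ i) → e a' < N →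
      coeff (e + Finsupp.single a (α + β)) ((∑ l ∈ Finset.range (β + 1),
        monomial (Finsupp.single a (α + l) + Finsupp.single a' (β - l)) (((β.choose l : ℕ) : K) * t ^ l)) * Q) = 0) :
    ∀ e : Fin 4 →₀ ℕ, e a + e a' = D → (∀ i, i ≠ a → i ≠ a' → e i = κ i) → e a' < N → coeff e Q = 0 := by
  suffices hmain : ∀ n, ∀ e : Fin 4 →₀ ℕ, e a + e a' = D → (∀ i, i ≠ a → i ≠ a' → e i = κ i) → e a' = n →
      n < N → coeff e Q = 0 from
    fun e hD hκ hN => hmain (e a') e hD hκ rfl hN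
  intro n
  induction n using Nat.strong_induction_on with
  | _ n ih =>
    intro e hD hκ hn hN
    have hsum := h e hD hκ (by omega)
    rw [coeff_unitRow_mul] at hsum
    -- only the term `l = β` survives
    rw [Finset.sum_eq_single_of_mem β (Finset.mem_range.mpr (by omega))] at hsum
    · have hle : Finsupp.single a (α + β) + Finsupp.single a' (β - β) ≤ e + Finsupp.single a (α + β) := by
        rw [Nat.sub_self, Finsupp.single_zero, add_zero]
        exact Finsupp.le_def.mpr fun i => by rw [Finsupp.add_apply]; exact le_add_self
      rw [if_pos hle, Nat.choose_self, Nat.cast_one, one_mul] at hsum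
      have hsub : e + Finsupp.single a (α + β) - (Finsupp.single a (α + β) + Finsupp.single a' (β - β)) = e := by
        rw [Nat.sub_self, Finsupp.single_zero, add_zero, add_tsub_cancel_right]
      rw [hsub] at hsum
      exact (mul_eq_zero.mp hsum).resolve_left (pow_ne_zero _ ht)
    · intro l hl hlβ
      have hl' : l < β := lt_of_le_of_ne (by have := Finset.mem_range.mp hl; omega) hlβ
      split_ifs with hle
      · -- the shifted exponent has smaller `x_{a′}`-exponent: induction hypothesis
        set e' := e + Finsupp.single a (α + β) - (Finsupp.single a (α + l) + Finsupp.single a' (β - l)) with he'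
        have hβl : β - l ≤ e a' := by
          have := Finsupp.le_def.mp hle a'
          rw [Finsupp.add_apply, Finsupp.add_apply, Finsupp.single_eq_of_ne haa.symm, Finsupp.single_eq_of_ne haa.symm,
            Finsupp.single_eq_same, add_zero, zero_add] at this
          exact this
        have he'a : e' a = e a + (β - l) := by
          rw [he', Finsupp.tsub_apply, Finsupp.add_apply, Finsupp.add_apply, Finsupp.single_eq_same,
            Finsupp.single_eq_same, Finsupp.single_eq_of_ne haa, add_zero]
          omega
        have he'a' : e' a' = e a' - (β - l) := by
          rw [he', Finsupp.tsub_apply, Finsupp.add_apply, Finsupp.add_apply, Finsupp.single_eq_of_ne haa.symm,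
            Finsupp.single_eq_of_ne haa.symm, Finsupp.single_eq_same, add_zero, zero_add]
        have he'i : ∀ i, i ≠ a → i ≠ a' → e' i = κ i := by
          intro i hia hia'
          rw [he', Finsupp.tsub_apply, Finsupp.add_apply, Finsupp.add_apply, Finsupp.single_eq_of_ne hia,
            Finsupp.single_eq_of_ne hia, Finsupp.single_eq_of_ne hia', add_zero, add_zero, Nat.sub_zero, hκ i hia hia']
        have hcoeff : coeff e' Q = 0 :=
          ih (e' a') (by rw [he'a']; omega) e' (by rw [he'a, he'a']; omega) he'i rfl (by rw [he'a']; omega)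
        rw [hcoeff, mul_zero]
      · rfl

end Peel

section Rows

/-- Row monomials with an inert offset `μ₀` (`μ₀_a = μ₀_{a′} = 0`), evaluated. [folklore] -/
theorem rowExp_add_apply {a a' : Fin 4} (haa : a ≠ a') {μ₀ : Fin 4 →₀ ℕ} (hμa : μ₀ a = 0) (hμa' : μ₀ a' = 0)
    (n j : ℕ) (i : Fin 4) :
    (Finsupp.single a (n - j) + Finsupp.single a' j + μ₀ : Fin 4 →₀ ℕ) i =
      if i = a then n - j else if i = a' then j else μ₀ i := by
  rw [Finsupp.add_apply, rowExp_apply haa]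
  by_cases hia : i = a
  · rw [if_pos hia, if_pos hia, hia, hμa, add_zero]
  · rw [if_neg hia, if_neg hia]
    by_cases hia' : i = a'
    · rw [if_pos hia', if_pos hia', hia', hμa', add_zero]
    · rw [if_neg hia', if_neg hia', zero_add]

/-- The SOURCE of the `l`-th binomial term at an offset row monomial is the row monomial `l` places further
(cf. `src_rowExp`). [folklore] -/
theorem src_rowExp_add {a a' : Fin 4} (haa : a ≠ a') {μ₀ : Fin 4 →₀ ℕ} (hμa : μ₀ a = 0) (hμa' : μ₀ a' = 0)
    (n j l : ℕ) :
    (((Finsupp.single a (n - j) + Finsupp.single a' j + μ₀ : Fin 4 →₀ ℕ).update a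
        ((Finsupp.single a (n - j) + Finsupp.single a' j + μ₀ : Fin 4 →₀ ℕ) a - l)).update a'
        ((Finsupp.single a (n - j) + Finsupp.single a' j + μ₀ : Fin 4 →₀ ℕ) a' + l)) =
      Finsupp.single a (n - (j + l)) + Finsupp.single a' (j + l) + μ₀ := by
  have hva : (Finsupp.single a (n - j) + Finsupp.single a' j + μ₀ : Fin 4 →₀ ℕ) a = n - j := by
    rw [rowExp_add_apply haa hμa hμa', if_pos rfl]
  have hva' : (Finsupp.single a (n - j) + Finsupp.single a' j + μ₀ : Fin 4 →₀ ℕ) a' = j := by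
    rw [rowExp_add_apply haa hμa hμa', if_neg haa.symm, if_pos rfl]
  ext i
  rw [Finsupp.coe_update, Finsupp.coe_update, hva, hva', rowExp_add_apply haa hμa hμa']
  by_cases hia' : i = a'
  · have hia : ¬ i = a := fun h => haa (h.symm.trans hia')
    rw [hia', Function.update_self, if_neg haa.symm, if_pos rfl]
  · rw [Function.update_of_ne hia']
    by_cases hia : i = a
    · rw [hia, Function.update_self, if_pos rfl]; omega
    · rw [Function.update_of_ne hia, rowExp_add_apply haa hμa hμa', if_neg hia, if_neg hia', if_neg hia, if_neg hia']

/-- **TRIANGULARITY OF THE SHEAR ON A ROW**: if every row monomial `x_a^{n−j} x_{a′}^j x^{μ₀}` (`j ≤ n`) has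
coefficient `0` in `shear a (t e_{a′}) G`, then every one has coefficient `0` in `G` (downward induction on `j`; the
diagonal of `coeff_shear_single` is `C(j, 0) = 1`). [folklore] [cite: Hauser2010, §I (definition of P⁺)] -/
theorem row_coeff_eq_zero_of_shear {a a' : Fin 4} (haa : a ≠ a') (t : K) (G : MvPolynomial (Fin 4) K) (n : ℕ)
    {μ₀ : Fin 4 →₀ ℕ} (hμa : μ₀ a = 0) (hμa' : μ₀ a' = 0)
    (h : ∀ j, j ≤ n →
      coeff (Finsupp.single a (n - j) + Finsupp.single a' j + μ₀) (shear a (Pi.single a' t) G) = 0) :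
    ∀ j, j ≤ n → coeff (Finsupp.single a (n - j) + Finsupp.single a' j + μ₀) G = 0 := by
  have key : ∀ j, j ≤ n → (∀ j', j < j' → j' ≤ n →
      coeff (Finsupp.single a (n - j') + Finsupp.single a' j' + μ₀) G = 0) →
      coeff (Finsupp.single a (n - j) + Finsupp.single a' j + μ₀) G = 0 := by
    intro j hj hlater
    have hEq := h j hj
    rw [coeff_shear_single haa] at hEq
    have hva : (Finsupp.single a (n - j) + Finsupp.single a' j + μ₀ : Fin 4 →₀ ℕ) a = n - j := by
      rw [rowExp_add_apply haa hμa hμa', if_pos rfl]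
    rw [Finset.sum_range_succ'] at hEq
    have hzero : ∑ l ∈ Finset.range ((Finsupp.single a (n - j) + Finsupp.single a' j + μ₀ : Fin 4 →₀ ℕ) a),
        (((Finsupp.single a (n - j) + Finsupp.single a' j + μ₀ : Fin 4 →₀ ℕ) a' + (l + 1)).choose (l + 1) : K) *
          t ^ (l + 1) *
          coeff (((Finsupp.single a (n - j) + Finsupp.single a' j + μ₀ : Fin 4 →₀ ℕ).update a
            ((Finsupp.single a (n - j) + Finsupp.single a' j + μ₀ : Fin 4 →₀ ℕ) a - (l + 1))).update a'
            ((Finsupp.single a (n - j) + Finsupp.single a' j + μ₀ : Fin 4 →₀ ℕ) a' + (l + 1))) G = 0 := by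
      refine Finset.sum_eq_zero fun l hl => ?_
      have hl' := Finset.mem_range.mp hl
      rw [hva] at hl'
      rw [src_rowExp_add haa hμa hμa', hlater (j + (l + 1)) (by omega) (by omega), mul_zero]
    rw [hzero, zero_add, src_rowExp_add haa hμa hμa', Nat.add_zero, Nat.choose_zero_right, Nat.cast_one, pow_zero,
      one_mul, one_mul] at hEq
    exact hEq
  -- downward induction: `∀ k, ∀ j, n - k ≤ j → j ≤ n → …`
  suffices hrow : ∀ k, ∀ j, n - k ≤ j → j ≤ n →
      coeff (Finsupp.single a (n - j) + Finsupp.single a' j + μ₀) G = 0 from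
    fun j hj => hrow n j (by omega) hj
  intro k
  induction k with
  | zero =>
    intro j h1 h2
    exact key j h2 fun j' hj' hj'n => by exfalso; omega
  | succ k ih =>
    intro j h1 h2
    by_cases hj : n - k ≤ j
    · exact ih j hj h2
    · exact key j h2 fun j' hj' hj'n => ih j' (by omega) hj'n

/-- Coefficients of the ROW POLYNOMIAL `Σ_{k ≤ n} coeff_{e k} G · x^{e k}` at the row monomials. [folklore] -/
theorem coeff_rowSum {a a' : Fin 4} (haa : a ≠ a') (G : MvPolynomial (Fin 4) K) (n : ℕ) {j : ℕ} (hj : j ≤ n) :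
    coeff (Finsupp.single a (n - j) + Finsupp.single a' j)
      (∑ k ∈ Finset.range (n + 1), monomial (Finsupp.single a (n - k) + Finsupp.single a' k)
        (coeff (Finsupp.single a (n - k) + Finsupp.single a' k) G)) =
      coeff (Finsupp.single a (n - j) + Finsupp.single a' j) G := by
  rw [coeff_sum]
  simp_rw [coeff_monomial, ite_rowExp haa]
  rw [Finset.sum_ite_eq (Finset.range (n + 1)) j, if_pos (Finset.mem_range.mpr (by omega))]

/-- The row polynomial is supported on the row. [folklore] -/
theorem exists_of_mem_support_rowSum {a a' : Fin 4} (G : MvPolynomial (Fin 4) K) (n : ℕ) {d : Fin 4 →₀ ℕ}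
    (hd : d ∈ (∑ k ∈ Finset.range (n + 1), monomial (Finsupp.single a (n - k) + Finsupp.single a' k)
        (coeff (Finsupp.single a (n - k) + Finsupp.single a' k) G)).support) :
    ∃ j, j ≤ n ∧ d = Finsupp.single a (n - j) + Finsupp.single a' j := by
  classical
  obtain ⟨k, hk, hdk⟩ := Finset.mem_biUnion.mp (Finset.mem_of_subset support_sum hd)
  refine ⟨k, by have := Finset.mem_range.mp hk; omega, ?_⟩
  rw [MvPolynomial.mem_support_iff, coeff_monomial] at hdk
  by_contra hne
  exact hdk (if_neg (Ne.symm hne))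

/-- **ROW LOCALITY OF THE SHEAR**: on the row monomials, the shear of the row polynomial of `G` has the same
coefficients as the shear of `G`. [folklore] [cite: Hauser2010, §I (definition of P⁺)] -/
theorem coeff_shear_rowSum {a a' : Fin 4} (haa : a ≠ a') (t : K) (G : MvPolynomial (Fin 4) K) (n : ℕ) {j : ℕ}
    (hj : j ≤ n) :
    coeff (Finsupp.single a (n - j) + Finsupp.single a' j) (shear a (Pi.single a' t)
      (∑ k ∈ Finset.range (n + 1), monomial (Finsupp.single a (n - k) + Finsupp.single a' k)
        (coeff (Finsupp.single a (n - k) + Finsupp.single a' k) G))) =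
      coeff (Finsupp.single a (n - j) + Finsupp.single a' j) (shear a (Pi.single a' t) G) := by
  rw [coeff_shear_single haa, coeff_shear_single haa]
  refine Finset.sum_congr rfl fun l hl => ?_
  have hva : (Finsupp.single a (n - j) + Finsupp.single a' j : Fin 4 →₀ ℕ) a = n - j := by
    rw [rowExp_apply haa, if_pos rfl]
  have hl' := Finset.mem_range.mp hl
  rw [hva] at hl'
  rw [src_rowExp haa, coeff_rowSum haa G n (by omega)]

end Rows

end ResCone

end Summit.ResolutionOfSingularities.ResolutionOfSingularities.Theorems.PIDim4

end
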